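import Mathlib.LinearAlgebra.TensorProduct.Basis
import Mathlib.LinearAlgebra.FiniteDimensional.Lemmas
import Mathlib.LinearAlgebra.Dimension.Constructions
import Mathlib.RingTheory.TensorProduct.Finite
import Mathlib.RingTheory.Flat.Basic
import Mathlib.Order.CompactlyGenerated.Basic
import Literature.AlgebraicGeometry.Motives.HodgeTensor
import Literature.AlgebraicGeometry.Motives.HodgeStructureProofs
import Literature.AlgebraicGeometry.Motives.HodgeTensorProofs
import HarnessLib

/-!
# Hodge numbers of a tensor product of Hodge structures (discharge of `hodgeNumber_tensor`)

This file discharges the named fact `Literature.AlgebraicGeometry.Motives.HodgeStructure.hodgeNumber_tensor` of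
`Literature/AlgebraicGeometry/Motives/HodgeTensor.lean`
(`Literature.AlgebraicGeometry.Motives.HodgeStructure.hodgeNumber_tensor_holds`): for pure `ℚ`-Hodge structures `H₁` of weight
`n` on `V` and `H₂` of weight `m` on `W` (`V`, `W` finite-dimensional), the Hodge numbers of the
tensor product `H₁ ⊗ H₂` (weight `n + m`, filtration
`F^p (V ⊗ W)_ℂ = Σ_{p ≤ a + b} F^a V_ℂ ⊗ F^b W_ℂ`, `HodgeStructure.tensor`) are
`h^{p,q}(H₁ ⊗ H₂) = Σ_{a,b} h^{a,b}(H₁) · h^{p-a,q-b}(H₂)`.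
This is the dimension count of the bigrading of a tensor product of Hodge structures,
`(A ⊗ B)^{i,j} = ⊕_{p,q} A^{p,q} ⊗ B^{i-p,j-q}` (Deligne, *Théorie de Hodge II*, 1.1.12 with
1.2.5; Carlson–Müller-Stach–Peters, *Period Mappings and Period Domains*, 2nd ed., §1.2, p. 52,
displayed formula; El Zein–Lê, Ch. 3 of Cattani–El Zein–Griffiths–Lê, *Hodge Theory*, §3.1.1.3
(1)(ii), p. 131, and §3.2.2.7 (1)(iii), p. 163, for the filtration
`F^r(H ⊗ H')_ℂ = Σ_{p+p'=r} F^p H_ℂ ⊗ F^{p'} H'_ℂ`). The statement proved is the vendored one,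
verbatim (it quantifies over all `p q : ℤ`; off the line `p + q = n + m` both sides vanish).

The companion file `HodgeTensorProofs` proves that `H₁ ⊗ H₂` *is* a Hodge structure
(`isCompl_tensorFiltration_holds`) and supplies the two structural inputs used here: the family
`V^{i,n-i} ⊗ W^{j,m-j} ⊆ V_ℂ ⊗_ℂ W_ℂ` is independent (`iSupIndep_map₂_mk`) and
`F^p (V ⊗ W) = Σ_{p ≤ i+j} V^{i,n-i} ⊗ W^{j,m-j}` (`tensorFiltration_eq_comap`).

## Proof

The sources define the tensor product through the bigrading and leave the comparison with the
filtration to the reader; the argument formalised here is the following dimension count.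

1. For any pure Hodge structure `H` of weight `n` on a finite-dimensional space and any `p`,
   `h^{p,n-p}(H) + dim F^{p+1} = dim F^p` (`hodgeNumber_add_finrank_F_add_one`), because
   `F^p = F^{p+1} ⊕ V^{p,n-p}` — a direct consequence of the opposedness axiom
   `F^{p+1} ⊕ conj F^{n-p} = V_ℂ` (Deligne, Hodge II, 1.2.5). Applied to `H₁ ⊗ H₂` (a Hodge
   structure by the standing instance `HodgeTensorFacts`, which is a hypothesis *inside* the fact
   `hodgeNumber_tensor`), this reduces the claim to a formula for `dim F^p (V ⊗ W)_ℂ`.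
2. Let `V_ℂ = ⊕_i V^i` (`V^i = V^{i,n-i}`) and `W_ℂ = ⊕_j W^j` be the Hodge decompositions
   (`iSupIndep_piece_holds`, `iSup_piece_eq_top_holds` of `HodgeStructureProofs`). Under the
   reassociation `ℂ ⊗ (V ⊗ W) ≃ V_ℂ ⊗_ℂ W_ℂ` (`tensorBaseChange`), `F^p` becomes
   `Σ_{p ≤ i+j} V^i ⊗ W^j` (`tensorFiltration_eq_comap`), a sum which may be restricted to the
   finitely many `(i, j) ∈ I × J` with `V^i ≠ 0 ≠ W^j` (`biSup_map₂_piece_eq_biSup_finset`).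
3. The subspaces `V^i ⊗ W^j ⊆ V_ℂ ⊗ W_ℂ` form an independent family (`iSupIndep_map₂_mk`),
   `dim (V^i ⊗ W^j) = dim V^i · dim W^j` (`finrank_map₂_mk`, injectivity of
   `V^i ⊗ W^j → V_ℂ ⊗ W_ℂ` over a field), and the dimension of a finite sum of an independent
   family is the sum of the dimensions (`finrank_biSup_eq_sum_of_iSupIndep`).
4. Hence `dim F^p(V ⊗ W)_ℂ = Σ_{p ≤ i+j} h^{i,n-i}(H₁) h^{j,m-j}(H₂)` (`finrank_tensorFiltration`),
   and subtracting the same sum over `p + 1 ≤ i + j` leaves the terms `i + j = p`, which are the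
   nonzero terms of `Σ_{a,b} h^{a,b}(H₁) h^{p-a,q-b}(H₂)` when `p + q = n + m`
   (`hodgeNumber_tensor_holds`).

## Main results

* `Literature.AlgebraicGeometry.Motives.finrank_biSup_eq_sum_of_iSupIndep`, `Literature.AlgebraicGeometry.Motives.finrank_map₂_mk`: the linear algebra of step 3.
* `Literature.AlgebraicGeometry.Motives.HodgeStructure.hodgeNumber_add_finrank_F_add_one`: `h^{p,n-p} + dim F^{p+1} = dim F^p`.
* `Literature.AlgebraicGeometry.Motives.HodgeStructure.finrank_tensorFiltration`: the dimension of `F^p (H₁ ⊗ H₂)`.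
* `Literature.HodgeStructure.hodgeNumber_tensor_holds : hodgeNumber_tensor`: the discharge.

## References

* P. Deligne, *Théorie de Hodge. II*, Publ. Math. IHÉS 40 (1971), 5–57: 1.1.12 (tensor product
  of filtered objects, `F^p(A ⊗ B) = Σ_{a+b=p} F^a A ⊗ F^b B`), 1.2.5 (bigrading attached to
  `n`-opposed filtrations), 2.1 (Hodge structures). The locator carried by the fact's cite tag.
  (Not held locally: doi:10.1007/bf02684692, acquisition requested; the statements used are
  those reprinted in the two held references below.) [DeligneHodgeII1971]
* J. Carlson, S. Müller-Stach, C. Peters, *Period Mappings and Period Domains*, 2nd ed.,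
  Cambridge Studies in Advanced Mathematics 168 (2017), §1.2, p. 52:
  "`(A ⊗ B)^{i,j} := ⊕_{p,q} A^{p,q} ⊗ B^{i-p,j-q}`". [CarlsonMullerStachPeters2017]
* F. El Zein, Lê D. T., *Mixed Hodge structures*, Ch. 3 in: E. Cattani, F. El Zein,
  P. A. Griffiths, Lê D. T. (eds.), *Hodge Theory*, Mathematical Notes 49, Princeton (2014):
  §3.1.1.3 (1)(ii), p. 131 ("the bigrading of `(H ⊗ H')_ℂ = H_ℂ ⊗ H'_ℂ` is the tensor product of
  the bigradings"); Prop. 3.2.10 and Def. 3.2.12, p. 156 (`F^p = ⊕_{i ≥ p} H^{i,n-i}`);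
  §3.2.2.7 (1)(iii), p. 163 (`F^r(H ⊗ H')_ℂ := Σ_{p+p'=r} F^p H_ℂ ⊗ F^{p'} H'_ℂ`).
  [CattaniElZeinGriffithsLe2014]
-/

open scoped TensorProduct
open Module

noncomputable section

namespace Literature.AlgebraicGeometry.Motives

/-! ### Linear algebra: dimensions of sums of independent subspaces and of `P ⊗ Q` -/

section LinearAlgebra

variable {K : Type*} [DivisionRing K] {X : Type*} [AddCommGroup X] [Module K X]

/-- The dimension of a finite sum of an *independent* family of subspaces of a finite-dimensional
vector space is the sum of the dimensions: `dim (⊕_{k ∈ s} U_k) = Σ_{k ∈ s} dim U_k`. (Induction on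
`s`, using `dim (A + B) + dim (A ∩ B) = dim A + dim B` and `U_a ∩ Σ_{k ∈ s} U_k = 0` for `a ∉ s`,
which is the independence.) [folklore] -/
theorem finrank_biSup_eq_sum_of_iSupIndep [FiniteDimensional K X] {κ : Type*}
    {U : κ → Submodule K X} (hU : iSupIndep U) (s : Finset κ) :
    finrank K ↥(⨆ k ∈ s, U k) = ∑ k ∈ s, finrank K (U k) := by
  classical
  induction s using Finset.induction_on with
  | empty => simp
  | insert a s ha ih =>
    rw [Finset.iSup_insert, Finset.sum_insert ha, ← ih]
    have hdisj : Disjoint (U a) (⨆ k ∈ s, U k) := by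
      have h := hU.disjoint_biSup (x := a) (y := (↑s : Set κ)) (by simpa using ha)
      simpa using h
    have h := Submodule.finrank_sup_add_finrank_inf_eq (U a) (⨆ k ∈ s, U k)
    rwa [hdisj.eq_bot, finrank_bot, add_zero] at h

end LinearAlgebra

section TensorProduct

variable {K : Type*} [Field K] {M N : Type*} [AddCommGroup M] [Module K M] [AddCommGroup N]
  [Module K N]

/-- Over a field, `dim (P ⊗ Q) = dim P · dim Q` for the subspace `P ⊗ Q ⊆ M ⊗ N` spanned by the
`x ⊗ y`, `x ∈ P`, `y ∈ Q` (Mathlib's `Submodule.map₂ (TensorProduct.mk K M N) P Q`): the map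
`P ⊗ Q → M ⊗ N` is injective (flatness) with this image. [folklore] -/
theorem finrank_map₂_mk (P : Submodule K M) (Q : Submodule K N) :
    finrank K ↥(Submodule.map₂ (TensorProduct.mk K M N) P Q) = finrank K P * finrank K Q := by
  rw [← TensorProduct.range_mapIncl,
    LinearMap.finrank_range_of_inj (Module.Flat.tensorProduct_mapIncl_injective_of_left P Q),
    Module.finrank_tensorProduct]

end TensorProduct

/-- Splitting a sum over the lattice points of `s ⊆ ℤ × ℤ` on or above the antidiagonal
`i + j = p` into the antidiagonal and the points on or above `i + j = p + 1`. [folklore] -/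
theorem sum_filter_le_add_eq_sum_filter_eq_add (s : Finset (ℤ × ℤ)) (f : ℤ × ℤ → ℕ) (p : ℤ) :
    ∑ k ∈ s.filter (fun k : ℤ × ℤ => p ≤ k.1 + k.2), f k =
      ∑ k ∈ s.filter (fun k : ℤ × ℤ => k.1 + k.2 = p), f k +
        ∑ k ∈ s.filter (fun k : ℤ × ℤ => p + 1 ≤ k.1 + k.2), f k := by
  rw [← Finset.sum_filter_add_sum_filter_not _ (fun k : ℤ × ℤ => k.1 + k.2 = p),
    Finset.filter_filter, Finset.filter_filter]
  congr 1
  · exact Finset.sum_congr (Finset.filter_congr fun k _ => by omega) fun _ _ => rfl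
  · exact Finset.sum_congr (Finset.filter_congr fun k _ => by omega) fun _ _ => rfl

namespace HodgeStructure

universe u v

variable {V : Type u} [AddCommGroup V] [Module ℚ V]
variable {W : Type v} [AddCommGroup W] [Module ℚ W]
variable {n m : ℤ}

/-! ### Hodge numbers as jumps of the Hodge filtration -/

/-- For a pure Hodge structure of weight `n` on a finite-dimensional `V` and any `p`,
`h^{p,n-p} + dim F^{p+1} = dim F^p`, i.e. `h^{p,n-p} = dim Gr_F^p V_ℂ`: indeed
`F^p = F^{p+1} ⊕ V^{p,n-p}` — given `x ∈ F^p`, write `x = y + z` with `y ∈ F^{p+1}`,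
`z ∈ conj F^{n-p}` (opposedness `F^{p+1} ⊕ conj F^{n-p} = V_ℂ` at `(p+1) + (n-p) = n+1`), so that
`z = x - y ∈ F^p ∩ conj F^{n-p} = V^{p,n-p}`; and `F^{p+1} ∩ V^{p,n-p} ⊆ F^{p+1} ∩ conj F^{n-p} = 0`
(Deligne, Hodge II, 1.2.5: `F^p = ⊕_{i ≥ p} V^{i,n-i}`; El Zein–Lê, Prop. 3.2.10 and Def. 3.2.12,
p. 156). [cite: DeligneHodgeII1971, 1.2.5] -/
theorem hodgeNumber_add_finrank_F_add_one [Module.Finite ℚ V] (H : HodgeStructure V n)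
    (p : ℤ) : H.hodgeNumber p (n - p) + finrank ℂ ↥(H.F (p + 1)) = finrank ℂ ↥(H.F p) := by
  have hc : IsCompl (H.F (p + 1)) (complexConj (H.F (n - p))) :=
    H.isCompl_F_complexConj (p + 1) (n - p) (by ring)
  have hsup : H.F (p + 1) ⊔ H.piece p (n - p) = H.F p := by
    refine le_antisymm (sup_le (H.antitone_F (by omega)) (piece_le_F H p (n - p))) ?_
    intro x hx
    have hx' : x ∈ H.F (p + 1) ⊔ complexConj (H.F (n - p)) := hc.sup_eq_top ▸ Submodule.mem_top
    obtain ⟨y, hy, z, hz, rfl⟩ := Submodule.mem_sup.1 hx'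
    refine Submodule.mem_sup.2 ⟨y, hy, z, ?_, rfl⟩
    rw [mem_piece_iff H (by ring : p + (n - p) = n)]
    exact ⟨by simpa using (H.F p).sub_mem hx (H.antitone_F (by omega) hy), hz⟩
  have hinf : H.F (p + 1) ⊓ H.piece p (n - p) = ⊥ :=
    (hc.disjoint.mono_right (piece_le_complexConj_F H p (n - p))).eq_bot
  have h := Submodule.finrank_sup_add_finrank_inf_eq (H.F (p + 1)) (H.piece p (n - p))
  rw [hsup, hinf, finrank_bot, add_zero] at h
  rw [h, hodgeNumber, add_comm]

/-- On a finite-dimensional `V` only finitely many Hodge pieces `V^{i,n-i}` are nonzero (an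
independent family of subspaces of a Noetherian module has finitely many nonzero members).
[folklore] -/
theorem exists_finset_piece_eq_bot [Module.Finite ℚ V] (H : HodgeStructure V n) :
    ∃ I : Finset ℤ, ∀ i ∉ I, H.piece i (n - i) = ⊥ := by
  refine ⟨(WellFoundedGT.finite_ne_bot_of_iSupIndep (iSupIndep_piece_holds H)).toFinset, ?_⟩
  intro i hi
  by_contra h
  exact hi ((Set.Finite.mem_toFinset _).2 h)

/-! ### The Hodge filtration of a tensor product: restriction to finitely many pieces -/

/-- The sum `Σ_{p ≤ i+j} V^{i,n-i} ⊗ W^{j,m-j}` over all `(i, j) ∈ ℤ × ℤ` (the right-hand side of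
`tensorFiltration_eq_comap`: `F^p (V ⊗ W)_ℂ` in terms of the Hodge bigradings, Deligne, Hodge II,
1.1.12 and 1.2.5; El Zein–Lê, §3.1.1.3 (1)(ii), p. 131) equals the same sum restricted to
`(i, j) ∈ I × J`, for any finite sets `I`, `J` outside which the Hodge pieces of `H₁`, `H₂` vanish
(the omitted terms are `0 ⊗ W^j = 0` or `V^i ⊗ 0 = 0`). [folklore] -/
theorem biSup_map₂_piece_eq_biSup_finset (H₁ : HodgeStructure V n) (H₂ : HodgeStructure W m)
    (I J : Finset ℤ) (hI : ∀ i ∉ I, H₁.piece i (n - i) = ⊥)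
    (hJ : ∀ j ∉ J, H₂.piece j (m - j) = ⊥) (p : ℤ) :
    ⨆ (ij : ℤ × ℤ) (_ : p ≤ ij.1 + ij.2),
        Submodule.map₂ (TensorProduct.mk ℂ (ℂ ⊗[ℚ] V) (ℂ ⊗[ℚ] W)) (H₁.piece ij.1 (n - ij.1))
          (H₂.piece ij.2 (m - ij.2)) =
      ⨆ ij ∈ (I ×ˢ J).filter (fun k : ℤ × ℤ => p ≤ k.1 + k.2),
        Submodule.map₂ (TensorProduct.mk ℂ (ℂ ⊗[ℚ] V) (ℂ ⊗[ℚ] W)) (H₁.piece ij.1 (n - ij.1))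
          (H₂.piece ij.2 (m - ij.2)) := by
  apply le_antisymm
  · refine iSup₂_le fun ij hij => ?_
    by_cases hk : ij ∈ I ×ˢ J
    · exact le_iSup₂_of_le (f := fun (k : ℤ × ℤ)
          (_ : k ∈ (I ×ˢ J).filter (fun k : ℤ × ℤ => p ≤ k.1 + k.2)) =>
          Submodule.map₂ (TensorProduct.mk ℂ (ℂ ⊗[ℚ] V) (ℂ ⊗[ℚ] W)) (H₁.piece k.1 (n - k.1))
            (H₂.piece k.2 (m - k.2)))
        ij (Finset.mem_filter.2 ⟨hk, hij⟩) le_rfl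
    · rw [Finset.mem_product, not_and_or] at hk
      rcases hk with hk | hk
      · rw [hI _ hk, Submodule.map₂_bot_left]
        exact bot_le
      · rw [hJ _ hk, Submodule.map₂_bot_right]
        exact bot_le
  · refine iSup₂_le fun ij hij => ?_
    obtain ⟨-, hp⟩ := Finset.mem_filter.1 hij
    exact le_iSup₂_of_le (f := fun (ij : ℤ × ℤ) (_ : p ≤ ij.1 + ij.2) =>
        Submodule.map₂ (TensorProduct.mk ℂ (ℂ ⊗[ℚ] V) (ℂ ⊗[ℚ] W)) (H₁.piece ij.1 (n - ij.1))
          (H₂.piece ij.2 (m - ij.2))) ij hp le_rfl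

/-- **Dimension of the Hodge filtration of a tensor product**:
`dim F^p (H₁ ⊗ H₂) = Σ_{(i,j) ∈ I × J, p ≤ i + j} h^{i,n-i}(H₁) · h^{j,m-j}(H₂)` for finite sets
`I`, `J` outside which the Hodge pieces of `H₁`, `H₂` vanish (`tensorFiltration_eq_comap` of
`HodgeTensorProofs`, independence of the `V^i ⊗ W^j` — `iSupIndep_map₂_mk` — and
`dim (V^i ⊗ W^j) = h^{i,n-i} h^{j,m-j}`). This is the dimension form of
`F^p (V ⊗ W)_ℂ = ⊕_{p ≤ i+j} V^{i,n-i} ⊗ W^{j,m-j}`, the filtration attached to the bigrading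
`(A ⊗ B)^{i,j} = ⊕_{p,q} A^{p,q} ⊗ B^{i-p,j-q}` (Deligne, Hodge II, 1.1.12 and 1.2.5;
Carlson–Müller-Stach–Peters, §1.2, p. 52; El Zein–Lê, §3.2.2.7 (1)(iii), p. 163).
[cite: CarlsonMullerStachPeters2017, §1.2 p. 52] -/
theorem finrank_tensorFiltration [Module.Finite ℚ V] [Module.Finite ℚ W] (H₁ : HodgeStructure V n)
    (H₂ : HodgeStructure W m) (I J : Finset ℤ) (hI : ∀ i ∉ I, H₁.piece i (n - i) = ⊥)
    (hJ : ∀ j ∉ J, H₂.piece j (m - j) = ⊥) (p : ℤ) :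
    finrank ℂ ↥(H₁.tensorFiltration H₂ p) =
      ∑ k ∈ (I ×ˢ J).filter (fun k : ℤ × ℤ => p ≤ k.1 + k.2),
        H₁.hodgeNumber k.1 (n - k.1) * H₂.hodgeNumber k.2 (m - k.2) := by
  have hind := iSupIndep_map₂_mk (K := ℂ) (iSupIndep_piece_holds H₁) (iSup_piece_eq_top_holds H₁)
    (iSupIndep_piece_holds H₂) (iSup_piece_eq_top_holds H₂)
  rw [tensorFiltration_eq_comap, Submodule.comap_equiv_eq_map_symm, LinearEquiv.finrank_map_eq,
    biSup_map₂_piece_eq_biSup_finset H₁ H₂ I J hI hJ p, finrank_biSup_eq_sum_of_iSupIndep hind]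
  simp only [finrank_map₂_mk]
  rfl

/-! ### The discharge -/

/-- **Hodge numbers of a tensor product**, discharging the named fact `hodgeNumber_tensor`:
`h^{p,q}(H₁ ⊗ H₂) = Σ_{a,b} h^{a,b}(H₁) · h^{p-a,q-b}(H₂)` for pure `ℚ`-Hodge structures `H₁`, `H₂`
of weights `n`, `m` on finite-dimensional `V`, `W` and all `p q : ℤ` — the dimension of the
bigrading `(A ⊗ B)^{i,j} = ⊕_{p,q} A^{p,q} ⊗ B^{i-p,j-q}` of the tensor product (Deligne,
*Théorie de Hodge II*, 1.1.12 with 1.2.5: `(V ⊗ W)^{p,q} = ⊕ V^{a,b} ⊗ W^{p-a,q-b}`; printed as the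
definition of `A ⊗ B` in Carlson–Müller-Stach–Peters, *Period Mappings and Period Domains*, 2nd
ed., §1.2, p. 52, and El Zein–Lê, §3.1.1.3 (1)(ii), p. 131, the filtration being
`F^r = Σ_{p+p'=r} F^p ⊗ F^{p'}`, §3.2.2.7 (1)(iii), p. 163 = `HodgeStructure.tensor`).

Proof: for `p + q ≠ n + m` both sides vanish (`h^{a,b}(H₁) ≠ 0` forces `a + b = n`, and then
`(p - a) + (q - b) ≠ m`). For `p + q = n + m`:
`h^{p,q}(H₁ ⊗ H₂) = dim F^p - dim F^{p+1}` (`hodgeNumber_add_finrank_F_add_one`, using that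
`H₁ ⊗ H₂` is a Hodge structure — the instance hypothesis `HodgeTensorFacts` of the fact), and
`dim F^p = Σ_{p ≤ i+j} h^{i,n-i}(H₁) h^{j,m-j}(H₂)` (`finrank_tensorFiltration`), so the
difference is the antidiagonal sum `Σ_{i+j=p} h^{i,n-i}(H₁) h^{j,m-j}(H₂)`, which is the given
`finsum` once the vanishing terms are dropped. [cite: DeligneHodgeII1971, 1.1.12] -/
theorem hodgeNumber_tensor_holds : hodgeNumber_tensor (V := V) (W := W) (n := n) (m := m) := by
  intro _ _ _ H₁ H₂ p q
  classical
  obtain ⟨I, hI⟩ := exists_finset_piece_eq_bot H₁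
  obtain ⟨J, hJ⟩ := exists_finset_piece_eq_bot H₂
  by_cases hpq : p + q = n + m
  · obtain rfl : q = n + m - p := by omega
    have key := fun p' => finrank_tensorFiltration H₁ H₂ I J hI hJ p'
    have h1 := hodgeNumber_add_finrank_F_add_one (H₁.tensor H₂) p
    rw [tensor_F, tensor_F, key p, key (p + 1),
      sum_filter_le_add_eq_sum_filter_eq_add (I ×ˢ J) _ p] at h1
    have hT := Nat.add_right_cancel h1
    rw [hT, Finset.sum_filter, Finset.sum_product]
    have inner : ∀ a : ℤ, ∑ᶠ b : ℤ, H₁.hodgeNumber a b * H₂.hodgeNumber (p - a) (n + m - p - b) =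
        H₁.hodgeNumber a (n - a) * H₂.hodgeNumber (p - a) (m - (p - a)) := by
      intro a
      rw [finsum_eq_single _ (n - a)]
      · rw [show n + m - p - (n - a) = m - (p - a) by omega]
      · intro b hb
        rw [hodgeNumber_eq_zero_of_add_ne H₁ (by omega), zero_mul]
    simp_rw [inner]
    rw [finsum_eq_sum_of_support_subset _ (s := I) ?_]
    · refine Finset.sum_congr rfl fun i _ => ?_
      rw [Finset.sum_eq_single (p - i)]
      · rw [if_pos (by omega)]
      · intro j _ hj
        rw [if_neg (by omega)]
      · intro hj
        rw [if_pos (by omega), hodgeNumber, hodgeNumber, hJ _ hj, finrank_bot, mul_zero]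
    · intro a ha
      rw [Function.mem_support] at ha
      by_contra haI
      apply ha
      rw [hodgeNumber, hI a haI, finrank_bot, zero_mul]
  · rw [hodgeNumber_eq_zero_of_add_ne _ hpq]
    have h0 : ∀ a b : ℤ, H₁.hodgeNumber a b * H₂.hodgeNumber (p - a) (q - b) = 0 := by
      intro a b
      by_cases hab : a + b = n
      · rw [hodgeNumber_eq_zero_of_add_ne H₂ (show p - a + (q - b) ≠ m by omega), mul_zero]
      · rw [hodgeNumber_eq_zero_of_add_ne H₁ hab, zero_mul]
    simp_rw [h0, finsum_zero]

end HodgeStructure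

end Literature.AlgebraicGeometry.Motives

end
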